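import Literature.Analysis.OperatorTheory.ShearResolventThinLevelSets
import Mathlib.Analysis.SpecialFunctions.Trigonometric.Deriv
import Mathlib.Analysis.SpecialFunctions.Trigonometric.Bounds
import Mathlib.Analysis.Calculus.MeanValue
import Mathlib.MeasureTheory.Measure.Lebesgue.Basic
import Mathlib.Topology.MetricSpace.HausdorffDistance
import HarnessLib

/-!
# The Kolmogorov shear profile `sin` has thin level sets: the resolvent crossover bound

For the Kolmogorov shear `v(y) = sin y` on the period cell `[0, 2π]`, this file VERIFIES the
thin-level-set hypothesis `Literature.Analysis.OperatorTheory.HasThinLevelSets` of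
`Literature.Analysis.OperatorTheory.ShearResolventThinLevelSets` (Coti Zelati–Gallay, J. London Math.
Soc. 108 (2023), Assumption 2.2 / Lemma 2.6: a Morse profile has `H¹`-thin level sets with degeneracy
index `m = 2`; Remark 3.2: on the torus every Morse function has critical points, so `m = 2` is the
relevant case for `v = sin`) with EXPLICIT constants, UNIFORMLY in the level `c ∈ ℝ`:

  `HasThinLevelSets (2π) (sin · − c) 2 (4(8π+32)²) 3 (π/(2(8π+32)))`  (`hasThinLevelSets_sin_sub`).

Consequently (CZG Prop. 2.4 ⟹ Thm 1.1 for `v = sin`, resolvent form; `Ψ₁(ϰ sin) ≥ C·min(ϰ², ϰ^{1/2})`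
in Wei's one-parameter normalisation): for all `ν > 0`, `k ≠ 0`, `c ∈ ℝ` and all `C²` functions `g` on
`[0, 2π]` with twisted-periodic boundary values `g(2π) = ωg(0)`, `g′(2π) = ωg′(0)`, `‖ω‖ = 1`,
* `kolmogorov_resolvent_enhanced` (`ν ≤ |k|`): `√(ν|k|)·‖g‖ ≤ C_K·‖−νg″ + ik(sin − c)g‖`,
* `kolmogorov_resolvent_taylor` (`|k| ≤ ν`): `(k²/ν)·‖g‖ ≤ C_K·‖−νg″ + ik(sin − c)g‖`,
with the SAME explicit constant `C_K = 4(π² + δ₀⁻² + 9δ₀⁻⁶)`, `δ₀ = π/(16π + 64)` (`L²(0, 2π)` norms as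
square roots of interval integrals). These are the `hres` inputs of the finite-dimensional
Gearhart–Prüss theorem `Literature.Analysis.OperatorTheory.GearhartPrussAccretive` for the frozen
Kolmogorov slot of the `ad-ideate` cell's K2R crossover lemma (all Bloch shifts `ω`, all levels `c`,
both regimes, one constant). HONEST CAVEAT: `C_K` is astronomically far from sharp (`δ₀⁻⁶ ≈ 10¹⁰`); the
statement's value is the uniformity (in `ν → 0`, `|k| → ∞`, `c`, `ω`) and the rate exponents; constants
are improvable by a certified computation on a compact band of `k/ν` or by CZG §3 (hypocoercivity).

Contents.
* `norm_sq_le_integral_div_add`, `setIntegral_norm_sq_le_of_measure_le` — the one-dimensional fact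
  behind CZG's Appendix A: a set of measure `≤ θ ≤ L/4` in `(0, L]` carries at most
  `½∫|f|² + 4θ²∫|f′|²` of any `C¹` function;
* (private) a `C¹` odd clamp `φ` and the localiser `χ = φ((sin − c)/(δ√(cos² + δ²)))` with
  `|χ′| ≤ 3/δ`;
* `volume_localiserSet_le` — the exceptional set `{|sin − c| < δ√(cos² + δ²)} ∩ (0, 2π]` has measure
  `≤ (8π + 32)δ` for `δ ≤ 1/4` (critical `2πδ`-neighbourhoods of `π/2`, `3π/2` via Jordan's inequality,
  plus four sets of regular crossings of diameter `≤ 8δ` by the mean value theorem for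
  `(sin − c)/cos`, whose derivative `(1 − c sin)/cos²` is `≥ ½` on them);
* `hasThinLevelSets_sin_sub`, `kolmogorov_resolvent_enhanced`, `kolmogorov_resolvent_taylor`.

No definitions, no named facts; everything is proved.
-/

noncomputable section

namespace Literature.Analysis.FluidPDE.KolmogorovShear

open scoped Real
open MeasureTheory intervalIntegral Set Real
open Literature.Analysis.OperatorTheory

section ThinFromMeasure

/-- **One-dimensional sup bound**: for `f` of class `C¹` on `[0, L]` (`L > 0`) and `y ∈ [0, L]`,
`|f(y)|² ≤ L⁻¹∫₀ᴸ |f|² + 2∫₀ᴸ |f||f′|` (value at a minimum point plus the variation of `|f|²`).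
[cite: CotizelatiGallay2023, Appendix A (H¹-thin sets, d = 1)] -/
theorem norm_sq_le_integral_div_add {L : ℝ} (hL : 0 < L) {f f' : ℝ → ℂ}
    (hf : ∀ y ∈ Icc 0 L, HasDerivAt f (f' y) y) (hf' : ContinuousOn f' (Icc 0 L))
    {y : ℝ} (hy : y ∈ Icc 0 L) :
    ‖f y‖ ^ 2 ≤ (∫ x in (0:ℝ)..L, ‖f x‖ ^ 2) / L + 2 * ∫ x in (0:ℝ)..L, ‖f x‖ * ‖f' x‖ := by
  have hI : uIcc (0:ℝ) L = Icc 0 L := uIcc_of_le hL.le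
  have hfc : ContinuousOn f (Icc 0 L) := fun x hx => (hf x hx).continuousAt.continuousWithinAt
  set F : ℝ → ℝ := fun x => ‖f x‖ ^ 2 with hF
  set F' : ℝ → ℝ := fun x => 2 * inner ℝ (f x) (f' x) with hF'
  have hFd : ∀ x ∈ Icc 0 L, HasDerivAt F (F' x) x := fun x hx => (hf x hx).norm_sq
  have hFc : ContinuousOn F (Icc 0 L) := hfc.norm.pow 2
  have hF'c : ContinuousOn F' (Icc 0 L) := (hfc.inner hf').const_smul (2:ℝ)
  -- a minimum point of `F`
  obtain ⟨x₀, hx₀, hmin⟩ := isCompact_Icc.exists_isMinOn (nonempty_Icc.2 hL.le) hFc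
  have hmin' : ∀ x ∈ Icc 0 L, F x₀ ≤ F x := fun x hx => hmin hx
  have h0 : F x₀ ≤ (∫ x in (0:ℝ)..L, ‖f x‖ ^ 2) / L := by
    rw [le_div_iff₀ hL]
    have h1 : ∫ x in (0:ℝ)..L, F x₀ = F x₀ * L := by simp [mul_comm]
    rw [← h1]
    exact intervalIntegral.integral_mono_on hL.le (by simp)
      (ContinuousOn.intervalIntegrable (by rw [hI]; exact hFc)) fun x hx => hmin' x hx
  -- `|F'| ≤ 2|f||f'|`
  have hF'le : ∀ x ∈ Icc 0 L, |F' x| ≤ 2 * (‖f x‖ * ‖f' x‖) := by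
    intro x _
    rw [hF', abs_mul, abs_of_pos (by norm_num : (0:ℝ) < 2)]
    exact mul_le_mul_of_nonneg_left (abs_real_inner_le_norm _ _) (by norm_num)
  have hprod : ContinuousOn (fun x => ‖f x‖ * ‖f' x‖) (Icc 0 L) := hfc.norm.mul hf'.norm
  -- variation bound between `x₀` and `y`
  have hvar : F y - F x₀ ≤ 2 * ∫ x in (0:ℝ)..L, ‖f x‖ * ‖f' x‖ := by
    have key : ∀ p q : ℝ, p ∈ Icc 0 L → q ∈ Icc 0 L → p ≤ q →
        |F q - F p| ≤ 2 * ∫ x in (0:ℝ)..L, ‖f x‖ * ‖f' x‖ := by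
      intro p q hp hq hpq
      have hsub : Icc p q ⊆ Icc 0 L := Icc_subset_Icc hp.1 hq.2
      have hftc : ∫ x in p..q, F' x = F q - F p :=
        intervalIntegral.integral_eq_sub_of_hasDerivAt
          (fun x hx => hFd x (hsub (by rwa [uIcc_of_le hpq] at hx)))
          (ContinuousOn.intervalIntegrable (by rw [uIcc_of_le hpq]; exact hF'c.mono hsub))
      rw [← hftc]
      calc |∫ x in p..q, F' x| ≤ ∫ x in p..q, |F' x| :=
            intervalIntegral.abs_integral_le_integral_abs hpq
        _ ≤ ∫ x in p..q, 2 * (‖f x‖ * ‖f' x‖) :=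
            intervalIntegral.integral_mono_on hpq
              (ContinuousOn.intervalIntegrable (by
                rw [uIcc_of_le hpq]; exact (hF'c.mono hsub).abs))
              (ContinuousOn.intervalIntegrable (by
                rw [uIcc_of_le hpq]; exact (hprod.mono hsub).const_smul (2:ℝ)))
              fun x hx => hF'le x (hsub hx)
        _ ≤ ∫ x in (0:ℝ)..L, 2 * (‖f x‖ * ‖f' x‖) := by
            refine intervalIntegral.integral_mono_interval hp.1 hpq hq.2 ?_ ?_
            · exact ae_restrict_of_forall_mem measurableSet_Ioc fun x hx =>
                mul_nonneg zero_le_two (mul_nonneg (norm_nonneg _) (norm_nonneg _))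
            · exact ContinuousOn.intervalIntegrable (by rw [hI]; exact hprod.const_smul (2:ℝ))
        _ = 2 * ∫ x in (0:ℝ)..L, ‖f x‖ * ‖f' x‖ := intervalIntegral.integral_const_mul _ _
    rcases le_total x₀ y with hle | hle
    · exact (le_abs_self _).trans (key x₀ y hx₀ hy hle)
    · have := key y x₀ hy hx₀ hle
      rw [abs_sub_comm] at this
      exact (le_abs_self _).trans this
  have : F y = ‖f y‖ ^ 2 := rfl
  linarith

/-- **Thin sets of small measure are `H¹`-thin** (CZG Appendix A in dimension one, quantitative form):
if `T ∩ (0, L]` has measure at most `θ ≤ L/4`, then every `C¹` function `f` on `[0, L]` satisfies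
`∫_{T ∩ (0,L]} |f|² ≤ ½∫₀ᴸ |f|² + 4θ² ∫₀ᴸ |f′|²`. [cite: CotizelatiGallay2023, §2 (2.7) and Appendix A] -/
theorem setIntegral_norm_sq_le_of_measure_le {L : ℝ} (hL : 0 < L) {f f' : ℝ → ℂ}
    (hf : ∀ y ∈ Icc 0 L, HasDerivAt f (f' y) y) (hf' : ContinuousOn f' (Icc 0 L))
    {T : Set ℝ} {θ : ℝ} (hθ : volume.real (T ∩ Ioc 0 L) ≤ θ) (hθL : θ ≤ L / 4) :
    ∫ y in T ∩ Ioc 0 L, ‖f y‖ ^ 2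
      ≤ 1 / 2 * (∫ y in (0:ℝ)..L, ‖f y‖ ^ 2) + 4 * θ ^ 2 * ∫ y in (0:ℝ)..L, ‖f' y‖ ^ 2 := by
  have hI : uIcc (0:ℝ) L = Icc 0 L := uIcc_of_le hL.le
  have hfc : ContinuousOn f (Icc 0 L) := fun x hx => (hf x hx).continuousAt.continuousWithinAt
  set a := ∫ x in (0:ℝ)..L, ‖f x‖ ^ 2 with ha
  set b := ∫ x in (0:ℝ)..L, ‖f' x‖ ^ 2 with hb
  set Y := ∫ x in (0:ℝ)..L, ‖f x‖ * ‖f' x‖ with hY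
  have ha0 : 0 ≤ a := intervalIntegral.integral_nonneg hL.le fun x _ => sq_nonneg _
  have hY0 : 0 ≤ Y := intervalIntegral.integral_nonneg hL.le fun x _ =>
    mul_nonneg (norm_nonneg _) (norm_nonneg _)
  have hθ0 : 0 ≤ θ := le_trans measureReal_nonneg hθ
  -- sup bound on `T ∩ (0, L]`
  have hsup : ∀ y ∈ T ∩ Ioc 0 L, ‖(‖f y‖ ^ 2 : ℝ)‖ ≤ a / L + 2 * Y := by
    intro y hy
    rw [Real.norm_of_nonneg (sq_nonneg _)]
    exact norm_sq_le_integral_div_add hL hf hf' (Ioc_subset_Icc_self hy.2)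
  have hfin : volume (T ∩ Ioc 0 L) < ⊤ :=
    (measure_mono inter_subset_right).trans_lt measure_Ioc_lt_top
  have h1 : ∫ y in T ∩ Ioc 0 L, ‖f y‖ ^ 2 ≤ (a / L + 2 * Y) * θ := by
    refine (le_abs_self _).trans ?_
    rw [← Real.norm_eq_abs]
    refine (norm_setIntegral_le_of_norm_le_const hfin hsup).trans ?_
    exact mul_le_mul_of_nonneg_left hθ (by positivity)
  -- `θ a / L ≤ a/4`
  have h2 : a / L * θ ≤ a / 4 := by
    rw [div_mul_eq_mul_div, div_le_div_iff₀ hL (by norm_num : (0:ℝ) < 4)]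
    nlinarith
  -- `2θY ≤ a/4 + 4θ² b` (Young)
  have h3 : 2 * Y * θ ≤ a / 4 + 4 * θ ^ 2 * b := by
    have hprod : IntervalIntegrable (fun x => ‖f x‖ * ‖f' x‖) volume 0 L :=
      ContinuousOn.intervalIntegrable (by rw [hI]; exact hfc.norm.mul hf'.norm)
    have ha' : IntervalIntegrable (fun x => ‖f x‖ ^ 2) volume 0 L :=
      ContinuousOn.intervalIntegrable (by rw [hI]; exact hfc.norm.pow 2)
    have hb' : IntervalIntegrable (fun x => ‖f' x‖ ^ 2) volume 0 L :=
      ContinuousOn.intervalIntegrable (by rw [hI]; exact hf'.norm.pow 2)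
    have key : ∫ x in (0:ℝ)..L, 2 * θ * (‖f x‖ * ‖f' x‖)
        ≤ ∫ x in (0:ℝ)..L, (‖f x‖ ^ 2 / 4 + 4 * θ ^ 2 * ‖f' x‖ ^ 2) := by
      refine intervalIntegral.integral_mono_on hL.le (hprod.const_mul _)
        ((ha'.div_const _).add (hb'.const_mul _)) fun x _ => ?_
      nlinarith [sq_nonneg (‖f x‖ / 2 - 2 * θ * ‖f' x‖)]
    rw [intervalIntegral.integral_const_mul, intervalIntegral.integral_add (ha'.div_const _)
      (hb'.const_mul _), intervalIntegral.integral_div, intervalIntegral.integral_const_mul] at key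
    linarith
  calc ∫ y in T ∩ Ioc 0 L, ‖f y‖ ^ 2 ≤ (a / L + 2 * Y) * θ := h1
    _ = a / L * θ + 2 * Y * θ := by ring
    _ ≤ a / 4 + (a / 4 + 4 * θ ^ 2 * b) := add_le_add h2 h3
    _ = 1 / 2 * a + 4 * θ ^ 2 * b := by ring

end ThinFromMeasure

section Localiser

/-- `C¹` gluing of two everywhere-differentiable real functions that agree to first order at the
gluing point. [folklore] -/
private theorem hasDerivAt_ite_le {f g f' g' : ℝ → ℝ} {p : ℝ} (hf : ∀ x, HasDerivAt f (f' x) x)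
    (hg : ∀ x, HasDerivAt g (g' x) x) (hfg : f p = g p) (hfg' : f' p = g' p) (x : ℝ) :
    HasDerivAt (fun y => if y ≤ p then f y else g y) (if x ≤ p then f' x else g' x) x := by
  rcases lt_trichotomy x p with hlt | rfl | hgt
  · rw [if_pos hlt.le]
    refine (hf x).congr_of_eventuallyEq ?_
    filter_upwards [Iio_mem_nhds hlt] with y hy
    rw [if_pos (le_of_lt hy)]
  · rw [if_pos le_rfl]
    have hl : HasDerivWithinAt (fun y => if y ≤ x then f y else g y) (f' x) (Iic x) x :=
      (hf x).hasDerivWithinAt.congr (fun y hy => by rw [if_pos (mem_Iic.mp hy)]) (by rw [if_pos le_rfl])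
    have hr : HasDerivWithinAt (fun y => if y ≤ x then f y else g y) (f' x) (Ici x) x := by
      rw [hfg']
      refine (hg x).hasDerivWithinAt.congr (fun y hy => ?_) (by rw [if_pos le_rfl, hfg])
      rcases eq_or_lt_of_le (mem_Ici.mp hy) with h | h
      · rw [← h, if_pos le_rfl, hfg]
      · rw [if_neg (not_le.mpr h)]
    have h := hl.union hr
    rwa [Iic_union_Ici, hasDerivWithinAt_univ] at h
  · rw [if_neg (not_le.mpr hgt)]
    refine (hg x).congr_of_eventuallyEq ?_
    filter_upwards [Ioi_mem_nhds hgt] with y hy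
    rw [if_neg (not_le.mpr hy)]

/-- **A `C¹` odd clamp** (regularised sign function, the `ϕ` of CZG's localiser made `C¹`): there are
`φ, φ′ : ℝ → ℝ` with `φ′` the continuous derivative of `φ`, `|φ| ≤ 1`, `|φ′| ≤ 2`, `φ(t)·t ≥ 0`,
and `φ(t) = sign t`, `φ′(t) = 0` for `|t| ≥ 1` (explicitly: `φ(t) = −1 | 2t + t² | 2t − t² | 1` on
`(−∞,−1] | [−1,0] | [0,1] | [1,∞)`). [folklore] -/
private theorem exists_clamp : ∃ φ φ' : ℝ → ℝ, (∀ t, HasDerivAt φ (φ' t) t) ∧ Continuous φ' ∧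
    (∀ t, |φ t| ≤ 1) ∧ (∀ t, |φ' t| ≤ 2) ∧ (∀ t, 0 ≤ φ t * t) ∧
    (∀ t, 1 ≤ |t| → φ t * t = |t|) ∧ (∀ t, 1 ≤ |t| → φ' t = 0) := by
  -- glue at `1`
  have h3 : ∀ x, HasDerivAt (fun y : ℝ => if y ≤ 1 then 2 * y - y ^ 2 else 1)
      (if x ≤ 1 then 2 - 2 * x else 0) x := by
    refine hasDerivAt_ite_le (f := fun y => 2 * y - y ^ 2) (g := fun _ => (1:ℝ))
      (f' := fun y => 2 - 2 * y) (g' := fun _ => (0:ℝ)) (fun y => ?_) (fun y => hasDerivAt_const _ _)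
      (by norm_num) (by norm_num)
    have h : HasDerivAt (fun y : ℝ => 2 * y - y ^ 2) (2 * 1 - ↑(2:ℕ) * y ^ (2 - 1) * 1) y :=
      ((hasDerivAt_id' y).const_mul 2).sub ((hasDerivAt_id' y).fun_pow 2)
    exact h.congr_deriv (by norm_num)
  -- glue at `0`
  have h2 : ∀ x, HasDerivAt
      (fun y : ℝ => if y ≤ 0 then 2 * y + y ^ 2 else (if y ≤ 1 then 2 * y - y ^ 2 else 1))
      (if x ≤ 0 then 2 + 2 * x else (if x ≤ 1 then 2 - 2 * x else 0)) x := by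
    refine hasDerivAt_ite_le (f := fun y => 2 * y + y ^ 2) (f' := fun y => 2 + 2 * y)
      (fun y => ?_) h3 (by norm_num) (by norm_num)
    have h : HasDerivAt (fun y : ℝ => 2 * y + y ^ 2) (2 * 1 + ↑(2:ℕ) * y ^ (2 - 1) * 1) y :=
      ((hasDerivAt_id' y).const_mul 2).add ((hasDerivAt_id' y).fun_pow 2)
    exact h.congr_deriv (by norm_num)
  -- glue at `-1`
  have h1 : ∀ x, HasDerivAt
      (fun y : ℝ => if y ≤ -1 then (-1:ℝ) else
        (if y ≤ 0 then 2 * y + y ^ 2 else (if y ≤ 1 then 2 * y - y ^ 2 else 1)))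
      (if x ≤ -1 then (0:ℝ) else (if x ≤ 0 then 2 + 2 * x else (if x ≤ 1 then 2 - 2 * x else 0))) x :=
    hasDerivAt_ite_le (f := fun _ => (-1:ℝ)) (f' := fun _ => (0:ℝ)) (fun y => hasDerivAt_const _ _)
      h2 (by norm_num) (by norm_num)
  refine ⟨_, _, h1, ?_, ?_, ?_, ?_, ?_, ?_⟩
  · -- continuity of `φ′`
    refine Continuous.if_le continuous_const ?_ continuous_id continuous_const (fun x hx => ?_)
    · refine Continuous.if_le (by fun_prop) ?_ continuous_id continuous_const (fun x hx => ?_)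
      · exact Continuous.if_le (by fun_prop) continuous_const continuous_id continuous_const
          (fun x hx => by rw [hx]; norm_num)
      · rw [hx]; norm_num
    · rw [hx]; norm_num
  · intro t
    split_ifs with h₁ h₂ h₃ <;> rw [abs_le] <;> constructor <;> nlinarith
  · intro t
    split_ifs with h₁ h₂ h₃ <;> rw [abs_le] <;> constructor <;> nlinarith
  · intro t
    split_ifs with h₁ h₂ h₃ <;> nlinarith
  · intro t ht
    rcases le_abs'.mp ht with h | h
    · rw [if_pos h, abs_of_neg (by linarith)]; ring
    · have h' : ¬ t ≤ -1 := by linarith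
      have h'' : ¬ t ≤ 0 := by linarith
      rw [if_neg h', if_neg h'', abs_of_pos (by linarith)]
      rcases eq_or_lt_of_le h with he | hlt
      · rw [if_pos he.symm.le, ← he]; ring
      · rw [if_neg (not_le.2 hlt)]; ring
  · intro t ht
    rcases le_abs'.mp ht with h | h
    · rw [if_pos h]
    · have h' : ¬ t ≤ -1 := by linarith
      have h'' : ¬ t ≤ 0 := by linarith
      rw [if_neg h', if_neg h'']
      rcases eq_or_lt_of_le h with he | hlt
      · rw [if_pos he.symm.le, ← he]; ring
      · rw [if_neg (not_le.2 hlt)]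

/-- The weight `w(y) = √(cos²y + δ²)` and its derivative. [folklore] -/
private theorem hasDerivAt_weight {δ : ℝ} (hδ : 0 < δ) (y : ℝ) :
    HasDerivAt (fun y => Real.sqrt (Real.cos y ^ 2 + δ ^ 2))
      (-(Real.sin y * Real.cos y) / Real.sqrt (Real.cos y ^ 2 + δ ^ 2)) y := by
  have hpos : 0 < Real.cos y ^ 2 + δ ^ 2 := by positivity
  have h1 : HasDerivAt (fun y => Real.cos y ^ 2 + δ ^ 2) (↑(2:ℕ) * Real.cos y ^ (2 - 1) * -Real.sin y) y :=
    ((Real.hasDerivAt_cos y).fun_pow 2).add_const (δ ^ 2)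
  have h := h1.sqrt hpos.ne'
  refine h.congr_deriv ?_
  push_cast
  field_simp

/-- **The localiser's inner function** `ψ(y) = (sin y − c)/(δ·√(cos²y + δ²))`: derivative and the
bound `|ψ′| ≤ 3/(2δ)` on `{|sin y − c| ≤ δ√(cos²y + δ²)}` (= `{|ψ| ≤ 1}`). [folklore] -/
private theorem hasDerivAt_psi {δ : ℝ} (hδ : 0 < δ) (c y : ℝ) :
    HasDerivAt (fun y => (Real.sin y - c) / (δ * Real.sqrt (Real.cos y ^ 2 + δ ^ 2)))
      (Real.cos y * ((Real.cos y ^ 2 + δ ^ 2) + (Real.sin y - c) * Real.sin y)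
        / (δ * Real.sqrt (Real.cos y ^ 2 + δ ^ 2) ^ 3)) y := by
  have hpos : 0 < Real.cos y ^ 2 + δ ^ 2 := by positivity
  have hw : 0 < Real.sqrt (Real.cos y ^ 2 + δ ^ 2) := Real.sqrt_pos.2 hpos
  have hw2 : Real.sqrt (Real.cos y ^ 2 + δ ^ 2) ^ 2 = Real.cos y ^ 2 + δ ^ 2 :=
    Real.sq_sqrt hpos.le
  have hD : δ * Real.sqrt (Real.cos y ^ 2 + δ ^ 2) ≠ 0 := by positivity
  have h := ((Real.hasDerivAt_sin y).sub_const c).div ((hasDerivAt_weight hδ y).const_mul δ) hD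
  refine h.congr_deriv ?_
  field_simp
  rw [hw2]
  ring

/-- The bound `|ψ′| ≤ 3/(2δ)` on the band `{|sin y − c| ≤ δ√(cos²y + δ²)}`. [folklore] -/
private theorem abs_psi_deriv_le {δ : ℝ} (hδ : 0 < δ) (c y : ℝ)
    (hy : |Real.sin y - c| ≤ δ * Real.sqrt (Real.cos y ^ 2 + δ ^ 2)) :
    |Real.cos y * ((Real.cos y ^ 2 + δ ^ 2) + (Real.sin y - c) * Real.sin y)
        / (δ * Real.sqrt (Real.cos y ^ 2 + δ ^ 2) ^ 3)| ≤ 3 / (2 * δ) := by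
  set w := Real.sqrt (Real.cos y ^ 2 + δ ^ 2) with hw
  have hpos : 0 < Real.cos y ^ 2 + δ ^ 2 := by positivity
  have hw0 : 0 < w := Real.sqrt_pos.2 hpos
  have hw2 : w ^ 2 = Real.cos y ^ 2 + δ ^ 2 := Real.sq_sqrt hpos.le
  have hcw : |Real.cos y| ≤ w := by
    rw [← Real.sqrt_sq_eq_abs, hw]
    exact Real.sqrt_le_sqrt (by nlinarith)
  have hsin : |Real.sin y| ≤ 1 := Real.abs_sin_le_one y
  -- numerator bound: `|cos|·(w² + δ w)`
  have hnum : |Real.cos y * ((Real.cos y ^ 2 + δ ^ 2) + (Real.sin y - c) * Real.sin y)|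
      ≤ |Real.cos y| * (w ^ 2 + δ * w) := by
    rw [abs_mul]
    refine mul_le_mul_of_nonneg_left ?_ (abs_nonneg _)
    refine (abs_add_le _ _).trans ?_
    rw [abs_of_pos hpos, ← hw2, abs_mul]
    have : |Real.sin y - c| * |Real.sin y| ≤ δ * w * 1 :=
      mul_le_mul hy hsin (abs_nonneg _) (by positivity)
    linarith
  rw [abs_div, abs_of_pos (by positivity : 0 < δ * w ^ 3)]
  rw [div_le_div_iff₀ (by positivity) (by positivity)]
  -- `|cos| (w² + δ w) · 2δ ≤ 3 · δ w³`, from `|cos| ≤ w` and `2δ|cos| ≤ w²`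
  have h1 : 2 * δ * |Real.cos y| ≤ w ^ 2 := by
    rw [hw2]; nlinarith [sq_nonneg (|Real.cos y| - δ), sq_abs (Real.cos y)]
  calc |Real.cos y * ((Real.cos y ^ 2 + δ ^ 2) + (Real.sin y - c) * Real.sin y)| * (2 * δ)
      ≤ |Real.cos y| * (w ^ 2 + δ * w) * (2 * δ) :=
        mul_le_mul_of_nonneg_right hnum (by positivity)
    _ = δ * (2 * (|Real.cos y| * w ^ 2) + (2 * δ * |Real.cos y|) * w) := by ring
    _ ≤ δ * (2 * (w * w ^ 2) + w ^ 2 * w) := by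
        refine mul_le_mul_of_nonneg_left ?_ hδ.le
        have e1 := mul_le_mul_of_nonneg_right hcw (sq_nonneg w)
        have e2 := mul_le_mul_of_nonneg_right h1 hw0.le
        linarith
    _ = 3 * (δ * w ^ 3) := by ring

end Localiser

section MeasureBound

/-- `cos²y / 2 ≤ 1 − |sin y|`. [folklore] -/
private theorem cos_sq_half_le_one_sub_abs_sin (y : ℝ) : cos y ^ 2 / 2 ≤ 1 - |sin y| := by
  have h1 : cos y ^ 2 = 1 - |sin y| ^ 2 := by rw [sq_abs, ← Real.sin_sq_add_cos_sq y]; ring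
  nlinarith [sq_nonneg (1 - |sin y|), abs_nonneg (sin y), Real.abs_sin_le_one y]

/-- Off the unit band of levels there is no regular crossing: if `|c| ≥ 1` and `|cos y| ≥ 4δ` then
`|sin y − c| ≥ 2δ|cos y|`. [folklore] -/
private theorem not_lt_of_one_le_abs {c δ y : ℝ} (hc : 1 ≤ |c|) (hcos : 4 * δ ≤ |cos y|) :
    ¬ |sin y - c| < 2 * δ * |cos y| := by
  intro h
  have h1 : |c| - |sin y| ≤ |sin y - c| := by
    have := abs_sub_abs_le_abs_sub c (sin y); rwa [abs_sub_comm] at this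
  have h2 := cos_sq_half_le_one_sub_abs_sin y
  have h3 : 2 * δ * |cos y| ≤ cos y ^ 2 / 2 := by
    rw [← sq_abs]; nlinarith [abs_nonneg (cos y)]
  have h4 : |sin y| ≤ 1 := abs_sin_le_one y
  linarith

/-- Derivative of `u = (sin − c)/cos` where `cos ≠ 0`: `u′ = (1 − c sin)/cos²`. [folklore] -/
private theorem hasDerivAt_tanLike {c ξ : ℝ} (hξ : cos ξ ≠ 0) :
    HasDerivAt (fun y => (sin y - c) / cos y) ((1 - c * sin ξ) / cos ξ ^ 2) ξ := by
  have h := ((Real.hasDerivAt_sin ξ).sub_const c).div (Real.hasDerivAt_cos ξ) hξ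
  refine h.congr_deriv ?_
  have := Real.sin_sq_add_cos_sq ξ
  field_simp
  nlinarith [this]

/-- **Regular crossings are `8δ`-short.** On an interval `[α, β]` on which `|cos|` is quasi-monotone
(`min(|cos a|, |cos b|) ≤ |cos ξ|` for `a ≤ ξ ≤ b`), two points with `|cos| ≥ 4δ` and
`|sin − c| < 2δ|cos|` are at distance `≤ 8δ` (mean value theorem for `u = (sin − c)/cos`, whose
derivative `(1 − c sin)/cos²` is `≥ ½` wherever `|u| < 2δ ≤ |cos|/2`). [folklore] -/
private theorem sub_le_of_crossing {α β c δ y₁ y₂ : ℝ} (hδ : 0 < δ)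
    (hmono : ∀ ⦃a ξ b : ℝ⦄, α ≤ a → a ≤ ξ → ξ ≤ b → b ≤ β → min |cos a| |cos b| ≤ |cos ξ|)
    (h1 : y₁ ∈ Icc α β) (h2 : y₂ ∈ Icc α β) (hle : y₁ ≤ y₂)
    (hc1 : 4 * δ ≤ |cos y₁|) (hs1 : |sin y₁ - c| < 2 * δ * |cos y₁|)
    (hc2 : 4 * δ ≤ |cos y₂|) (hs2 : |sin y₂ - c| < 2 * δ * |cos y₂|) :
    y₂ - y₁ ≤ 8 * δ := by
  rcases hle.eq_or_lt with heq | hlt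
  · rw [heq, sub_self]; positivity
  -- `|c| < 1`
  have hc : |c| < 1 := by
    by_contra h
    exact not_lt_of_one_le_abs (not_lt.1 h) hc1 hs1
  -- `|cos| ≥ 4δ` on `[y₁, y₂]`
  have hcos : ∀ ξ ∈ Icc y₁ y₂, 4 * δ ≤ |cos ξ| := fun ξ hξ =>
    (le_min hc1 hc2).trans (hmono h1.1 hξ.1 hξ.2 h2.2)
  have hcos0 : ∀ ξ ∈ Icc y₁ y₂, cos ξ ≠ 0 := fun ξ hξ h => by
    have := hcos ξ hξ; rw [h, abs_zero] at this; linarith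
  set u : ℝ → ℝ := fun y => (sin y - c) / cos y with hu
  set u' : ℝ → ℝ := fun y => (1 - c * sin y) / cos y ^ 2 with hu'
  have hud : ∀ ξ ∈ Icc y₁ y₂, HasDerivAt u (u' ξ) ξ := fun ξ hξ => hasDerivAt_tanLike (hcos0 ξ hξ)
  have hnum : ∀ ξ, 0 < 1 - c * sin ξ := fun ξ => by
    have : |c * sin ξ| < 1 := by
      rw [abs_mul]
      calc |c| * |sin ξ| ≤ |c| * 1 := mul_le_mul_of_nonneg_left (abs_sin_le_one ξ) (abs_nonneg c)
        _ < 1 := by linarith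
    linarith [(abs_lt.1 this).2]
  have hu'pos : ∀ ξ ∈ Icc y₁ y₂, 0 < u' ξ := fun ξ hξ =>
    div_pos (hnum ξ) (by have := hcos0 ξ hξ; positivity)
  have hcont : ContinuousOn u (Icc y₁ y₂) := fun ξ hξ => (hud ξ hξ).continuousAt.continuousWithinAt
  have hsm : StrictMonoOn u (Icc y₁ y₂) := by
    refine strictMonoOn_of_deriv_pos (convex_Icc y₁ y₂) hcont fun x hx => ?_
    rw [interior_Icc] at hx
    rw [(hud x (Ioo_subset_Icc_self hx)).deriv]
    exact hu'pos x (Ioo_subset_Icc_self hx)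
  -- `|u| < 2δ` at the endpoints
  have hub : ∀ y, 4 * δ ≤ |cos y| → |sin y - c| < 2 * δ * |cos y| → |u y| < 2 * δ := by
    intro y hcy hsy
    have hpos : 0 < |cos y| := lt_of_lt_of_le (by positivity) hcy
    simp only [hu, abs_div]
    rwa [div_lt_iff₀ hpos]
  have hu1 := hub y₁ hc1 hs1
  have hu2 := hub y₂ hc2 hs2
  -- mean value theorem
  obtain ⟨ξ, hξ, hslope⟩ := exists_hasDerivAt_eq_slope u u' hlt hcont
    (fun x hx => hud x (Ioo_subset_Icc_self hx))
  have hξI : ξ ∈ Icc y₁ y₂ := Ioo_subset_Icc_self hξ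
  have hcξ : 4 * δ ≤ |cos ξ| := hcos ξ hξI
  -- `|u ξ| < 2δ`
  have huξ : |u ξ| < 2 * δ := by
    have hl : u y₁ < u ξ := hsm (left_mem_Icc.2 hle) hξI hξ.1
    have hr : u ξ < u y₂ := hsm hξI (right_mem_Icc.2 hle) hξ.2
    rw [abs_lt] at hu1 hu2 ⊢
    exact ⟨by linarith [hu1.1], by linarith [hu2.2]⟩
  -- hence `|sin ξ − c| < 2δ|cos ξ|` and `u′ ξ ≥ 1/2`
  have hcξ0 : 0 < |cos ξ| := lt_of_lt_of_le (by positivity) hcξ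
  have hsξ : |sin ξ - c| < 2 * δ * |cos ξ| := by
    have := huξ; simp only [hu, abs_div] at this
    rwa [div_lt_iff₀ hcξ0] at this
  have hu'ξ : 1 / 2 ≤ u' ξ := by
    simp only [hu']
    rw [div_le_div_iff₀ (by norm_num) (by have := hcos0 ξ hξI; positivity)]
    have e1 : 1 - c * sin ξ = cos ξ ^ 2 + sin ξ * (sin ξ - c) := by
      have := Real.sin_sq_add_cos_sq ξ; nlinarith [this]
    have e2 : |sin ξ * (sin ξ - c)| ≤ 2 * δ * |cos ξ| := by
      rw [abs_mul]
      calc |sin ξ| * |sin ξ - c| ≤ 1 * |sin ξ - c| :=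
            mul_le_mul_of_nonneg_right (abs_sin_le_one ξ) (abs_nonneg _)
        _ ≤ 2 * δ * |cos ξ| := by rw [one_mul]; exact hsξ.le
    have e3 : 2 * δ * |cos ξ| ≤ cos ξ ^ 2 / 2 := by
      rw [← sq_abs]; nlinarith [abs_nonneg (cos ξ)]
    have e4 := neg_abs_le (sin ξ * (sin ξ - c))
    nlinarith
  -- conclude from the slope identity
  have hpos : 0 < y₂ - y₁ := sub_pos.2 hlt
  rw [hslope, le_div_iff₀ hpos] at hu'ξ
  rw [abs_lt] at hu1 hu2
  linarith [hu1.1, hu2.2]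

/-- `cos(2π − x) = cos x`. [folklore] -/
private theorem cos_two_pi_sub' (x : ℝ) : cos (2 * π - x) = cos x := by
  rw [Real.cos_sub, Real.cos_two_pi, Real.sin_two_pi]; ring

/-- Quasi-monotonicity of `|cos|` on the first quarter `[0, π/2]`. [folklore] -/
private theorem quarter1_mono ⦃a ξ b : ℝ⦄ (ha : 0 ≤ a) (haξ : a ≤ ξ) (hξb : ξ ≤ b)
    (hb : b ≤ π / 2) : min |cos a| |cos b| ≤ |cos ξ| := by
  have hcb : 0 ≤ cos b := cos_nonneg_of_mem_Icc ⟨by linarith [pi_pos], hb⟩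
  have hcξ : 0 ≤ cos ξ := cos_nonneg_of_mem_Icc ⟨by linarith [pi_pos], by linarith⟩
  have h : cos b ≤ cos ξ :=
    cos_le_cos_of_nonneg_of_le_pi (by linarith) (by linarith [pi_pos]) hξb
  rw [abs_of_nonneg hcb, abs_of_nonneg hcξ]
  exact (min_le_right _ _).trans h

/-- Quasi-monotonicity of `|cos|` on the second quarter `[π/2, π]`. [folklore] -/
private theorem quarter2_mono ⦃a ξ b : ℝ⦄ (ha : π / 2 ≤ a) (haξ : a ≤ ξ) (hξb : ξ ≤ b)
    (hb : b ≤ π) : min |cos a| |cos b| ≤ |cos ξ| := by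
  have hca : cos a ≤ 0 := cos_nonpos_of_pi_div_two_le_of_le ha (by linarith [pi_pos])
  have hcξ : cos ξ ≤ 0 := cos_nonpos_of_pi_div_two_le_of_le (by linarith) (by linarith [pi_pos])
  have h : cos ξ ≤ cos a :=
    cos_le_cos_of_nonneg_of_le_pi (by linarith [pi_pos]) (by linarith) haξ
  rw [abs_of_nonpos hca, abs_of_nonpos hcξ]
  exact (min_le_left _ _).trans (by linarith)

/-- Quasi-monotonicity of `|cos|` on the third quarter `[π, 3π/2]`. [folklore] -/
private theorem quarter3_mono ⦃a ξ b : ℝ⦄ (ha : π ≤ a) (haξ : a ≤ ξ) (hξb : ξ ≤ b)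
    (hb : b ≤ 3 * π / 2) : min |cos a| |cos b| ≤ |cos ξ| := by
  have hcb : cos b ≤ 0 := cos_nonpos_of_pi_div_two_le_of_le (by linarith [pi_pos]) (by linarith)
  have hcξ : cos ξ ≤ 0 :=
    cos_nonpos_of_pi_div_two_le_of_le (by linarith [pi_pos]) (by linarith [pi_pos])
  have h : cos ξ ≤ cos b := by
    rw [← cos_two_pi_sub' ξ, ← cos_two_pi_sub' b]
    exact cos_le_cos_of_nonneg_of_le_pi (by linarith) (by linarith) (by linarith)
  rw [abs_of_nonpos hcb, abs_of_nonpos hcξ]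
  exact (min_le_right _ _).trans (by linarith)

/-- Quasi-monotonicity of `|cos|` on the fourth quarter `[3π/2, 2π]`. [folklore] -/
private theorem quarter4_mono ⦃a ξ b : ℝ⦄ (ha : 3 * π / 2 ≤ a) (haξ : a ≤ ξ) (hξb : ξ ≤ b)
    (hb : b ≤ 2 * π) : min |cos a| |cos b| ≤ |cos ξ| := by
  have hca : 0 ≤ cos a := by
    rw [← cos_two_pi_sub' a]
    exact cos_nonneg_of_mem_Icc ⟨by linarith [pi_pos], by linarith⟩
  have hcξ : 0 ≤ cos ξ := by
    rw [← cos_two_pi_sub' ξ]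
    exact cos_nonneg_of_mem_Icc ⟨by linarith [pi_pos], by linarith⟩
  have h : cos a ≤ cos ξ := by
    rw [← cos_two_pi_sub' ξ, ← cos_two_pi_sub' a]
    exact cos_le_cos_of_nonneg_of_le_pi (by linarith) (by linarith [pi_pos]) (by linarith)
  rw [abs_of_nonneg hca, abs_of_nonneg hcξ]
  exact (min_le_left _ _).trans h

/-- The critical neighbourhoods: on `[0, π]`, `|cos z| < cos(π/2 − θ)` forces `|z − π/2| < θ`
(`0 < θ ≤ π/2`). [folklore] -/
private theorem mem_Ioo_of_abs_cos_lt {θ z : ℝ} (hθ : 0 < θ) (hθ' : θ ≤ π / 2)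
    (hz : z ∈ Icc 0 π) (h : |cos z| < cos (π / 2 - θ)) : z ∈ Ioo (π / 2 - θ) (π / 2 + θ) := by
  rcases le_or_gt z (π / 2) with hz' | hz'
  · have hcz : 0 ≤ cos z := cos_nonneg_of_mem_Icc ⟨by linarith [hz.1, pi_pos], hz'⟩
    rw [abs_of_nonneg hcz] at h
    refine ⟨?_, by linarith⟩
    by_contra hcon
    have : cos (π / 2 - θ) ≤ cos z :=
      cos_le_cos_of_nonneg_of_le_pi hz.1 (by linarith) (not_lt.1 hcon)
    linarith
  · have hcz : cos z ≤ 0 := cos_nonpos_of_pi_div_two_le_of_le hz'.le (by linarith [hz.2, pi_pos])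
    rw [abs_of_nonpos hcz, ← Real.cos_pi_sub] at h
    refine ⟨by linarith, ?_⟩
    by_contra hcon
    have : cos (π / 2 - θ) ≤ cos (π - z) :=
      cos_le_cos_of_nonneg_of_le_pi (by linarith [hz.2]) (by linarith) (by linarith [not_lt.1 hcon])
    linarith

/-- **The exceptional set of the Kolmogorov profile is `O(δ)`-small**: for `0 < δ ≤ 1/4` and every
level `c`, the set `{y ∈ (0, 2π] : |sin y − c| < δ√(cos²y + δ²)}` (where the localiser is not `±1`)
has Lebesgue measure at most `(8π + 32)δ`: it is covered by the two `2πδ`-neighbourhoods of the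
critical points `π/2`, `3π/2` (where `|cos| < 4δ`; Jordan's inequality) and, on each quarter period,
by a set of regular crossings of diameter `≤ 8δ` (`sub_le_of_crossing`). This is CZG's Lemma 2.6
(Morse profiles satisfy Assumption 2.2 with `m = 2`) made quantitative for `v = sin`.
[cite: CotizelatiGallay2023, §2 Lemma 2.6 and Remark 3.2] -/
theorem volume_localiserSet_le (c : ℝ) {δ : ℝ} (hδ : 0 < δ) (hδ4 : δ ≤ 1 / 4) :
    volume ({y : ℝ | |sin y - c| < δ * Real.sqrt (cos y ^ 2 + δ ^ 2)} ∩ Ioc 0 (2 * π))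
      ≤ ENNReal.ofReal ((8 * π + 32) * δ) := by
  set θ := 2 * π * δ with hθ
  have hθ0 : 0 < θ := by positivity
  have hθ1 : θ ≤ π / 2 := by rw [hθ]; nlinarith [pi_pos]
  have hsinθ : 4 * δ ≤ sin θ := by
    have h := Real.mul_le_sin hθ0.le hθ1
    have : 2 / π * θ = 4 * δ := by rw [hθ]; field_simp; ring
    linarith
  have hcosθ : cos (π / 2 - θ) = sin θ := Real.cos_pi_div_two_sub θ
  -- the covering sets
  set A₁ : Set ℝ := Ioo (π / 2 - θ) (π / 2 + θ) with hA₁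
  set A₂ : Set ℝ := Ioo (3 * π / 2 - θ) (3 * π / 2 + θ) with hA₂
  set T : ℝ → ℝ → Set ℝ := fun α β =>
    {y : ℝ | y ∈ Icc α β ∧ 4 * δ ≤ |cos y| ∧ |sin y - c| < 2 * δ * |cos y|} with hT
  -- covering
  have hcover : {y : ℝ | |sin y - c| < δ * Real.sqrt (cos y ^ 2 + δ ^ 2)} ∩ Ioc 0 (2 * π)
      ⊆ (A₁ ∪ A₂) ∪ ((T 0 (π / 2) ∪ T (π / 2) π) ∪ (T π (3 * π / 2) ∪ T (3 * π / 2) (2 * π))) := by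
    rintro y ⟨hyS, hyI⟩
    simp only [mem_setOf_eq] at hyS
    rcases lt_or_ge |cos y| (4 * δ) with hsmall | hbig
    · -- near a critical point
      left
      have hlt : |cos y| < cos (π / 2 - θ) := by rw [hcosθ]; linarith
      rcases le_or_gt y π with hyπ | hyπ
      · left; exact mem_Ioo_of_abs_cos_lt hθ0 hθ1 ⟨hyI.1.le, hyπ⟩ hlt
      · right
        have hz : 2 * π - y ∈ Icc 0 π := ⟨by linarith [hyI.2], by linarith⟩
        have hlt' : |cos (2 * π - y)| < cos (π / 2 - θ) := by rwa [cos_two_pi_sub']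
        have h := mem_Ioo_of_abs_cos_lt hθ0 hθ1 hz hlt'
        exact ⟨by linarith [h.2], by linarith [h.1]⟩
    · -- a regular crossing
      right
      have hw : Real.sqrt (cos y ^ 2 + δ ^ 2) ≤ |cos y| + δ := by
        rw [Real.sqrt_le_left (by positivity)]
        nlinarith [abs_nonneg (cos y), sq_abs (cos y), hδ.le]
      have hs : |sin y - c| < 2 * δ * |cos y| := by
        have : δ * Real.sqrt (cos y ^ 2 + δ ^ 2) ≤ 2 * δ * |cos y| := by
          have := mul_le_mul_of_nonneg_left hw hδ.le
          nlinarith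
        linarith
      rcases le_or_gt y (π / 2) with hq1 | hq1
      · exact Or.inl (Or.inl ⟨⟨hyI.1.le, hq1⟩, hbig, hs⟩)
      rcases le_or_gt y π with hq2 | hq2
      · exact Or.inl (Or.inr ⟨⟨hq1.le, hq2⟩, hbig, hs⟩)
      rcases le_or_gt y (3 * π / 2) with hq3 | hq3
      · exact Or.inr (Or.inl ⟨⟨hq2.le, hq3⟩, hbig, hs⟩)
      · exact Or.inr (Or.inr ⟨⟨hq3.le, hyI.2⟩, hbig, hs⟩)
  -- measures of the pieces
  have hA : ∀ m : ℝ, volume (Ioo (m - θ) (m + θ)) = ENNReal.ofReal (2 * θ) := fun m => by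
    rw [Real.volume_Ioo]; congr 1; ring
  have hTle : ∀ α β : ℝ,
      (∀ ⦃a ξ b : ℝ⦄, α ≤ a → a ≤ ξ → ξ ≤ b → b ≤ β → min |cos a| |cos b| ≤ |cos ξ|) →
      volume (T α β) ≤ ENNReal.ofReal (8 * δ) := by
    intro α β hmono
    refine (Real.volume_le_diam _).trans (Metric.ediam_le fun x hx y hy => ?_)
    simp only [hT, mem_setOf_eq] at hx hy
    rw [edist_dist, Real.dist_eq]
    apply ENNReal.ofReal_le_ofReal
    rw [abs_le]
    constructor
    · rcases le_total x y with hxy | hxy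
      · have := sub_le_of_crossing hδ hmono hx.1 hy.1 hxy hx.2.1 hx.2.2 hy.2.1 hy.2.2
        linarith
      · linarith [hδ.le]
    · rcases le_total y x with hxy | hxy
      · have := sub_le_of_crossing hδ hmono hy.1 hx.1 hxy hy.2.1 hy.2.2 hx.2.1 hx.2.2
        linarith
      · linarith [hδ.le]
  have hT1 := hTle 0 (π / 2) (fun a ξ b h1 h2 h3 h4 => quarter1_mono h1 h2 h3 h4)
  have hT2 := hTle (π / 2) π (fun a ξ b h1 h2 h3 h4 => quarter2_mono h1 h2 h3 h4)
  have hT3 := hTle π (3 * π / 2) (fun a ξ b h1 h2 h3 h4 => quarter3_mono h1 h2 h3 h4)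
  have hT4 := hTle (3 * π / 2) (2 * π) (fun a ξ b h1 h2 h3 h4 => quarter4_mono h1 h2 h3 h4)
  -- add up
  calc volume ({y : ℝ | |sin y - c| < δ * Real.sqrt (cos y ^ 2 + δ ^ 2)} ∩ Ioc 0 (2 * π))
      ≤ volume ((A₁ ∪ A₂) ∪ ((T 0 (π / 2) ∪ T (π / 2) π) ∪ (T π (3 * π / 2) ∪ T (3 * π / 2) (2 * π)))) :=
        measure_mono hcover
    _ ≤ (volume A₁ + volume A₂) + ((volume (T 0 (π / 2)) + volume (T (π / 2) π))
          + (volume (T π (3 * π / 2)) + volume (T (3 * π / 2) (2 * π)))) := by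
        refine (measure_union_le _ _).trans (add_le_add (measure_union_le _ _) ?_)
        exact (measure_union_le _ _).trans (add_le_add (measure_union_le _ _) (measure_union_le _ _))
    _ ≤ (ENNReal.ofReal (2 * θ) + ENNReal.ofReal (2 * θ))
          + ((ENNReal.ofReal (8 * δ) + ENNReal.ofReal (8 * δ))
          + (ENNReal.ofReal (8 * δ) + ENNReal.ofReal (8 * δ))) := by
        gcongr
        · exact (hA (π / 2)).le
        · exact (hA (3 * π / 2)).le
    _ = ENNReal.ofReal ((8 * π + 32) * δ) := by
        repeat rw [← ENNReal.ofReal_add (by positivity) (by positivity)]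
        congr 1
        rw [hθ]; ring

end MeasureBound

section Assembly

/-- **The Kolmogorov profile has thin level sets (`m = 2`), uniformly in the level `c`**:
`HasThinLevelSets (2π) (sin · − c) 2 C₀ 3 δ₀` with `C₀ = 4(8π+32)²`, `δ₀ = π/(2(8π+32))`; the
localiser is `φ((sin y − c)/(δ√(cos²y + δ²)))` for the `C¹` odd clamp `φ`, the exceptional set is
`{|sin − c| < δ√(cos² + δ²)}` (off which `χ(sin − c) = |sin − c| ≥ δ²`), and its smallness is
`volume_localiserSet_le`. (CZG Lemma 2.6 / Remark 3.2 for `v = sin`, quantitative.)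
[cite: CotizelatiGallay2023, §2 Assumption 2.2, Lemma 2.6, Remark 3.2] -/
theorem hasThinLevelSets_sin_sub (c : ℝ) :
    HasThinLevelSets (2 * π) (fun y => Real.sin y - c) 2 (4 * (8 * π + 32) ^ 2) 3
      (π / (2 * (8 * π + 32))) := by
  intro δ hδ hδ₀
  have hδ4 : δ ≤ 1 / 4 := hδ₀.trans (by
    rw [div_le_div_iff₀ (by positivity) (by norm_num)]; nlinarith [pi_pos])
  obtain ⟨φ, φ', hφd, hφ'c, hφ1, hφ'2, hφpos, hφsign, hφ'zero⟩ := exists_clamp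
  set w : ℝ → ℝ := fun y => Real.sqrt (cos y ^ 2 + δ ^ 2) with hw
  set ψ : ℝ → ℝ := fun y => (sin y - c) / (δ * w y) with hψ
  set ψ' : ℝ → ℝ := fun y =>
    cos y * ((cos y ^ 2 + δ ^ 2) + (sin y - c) * sin y) / (δ * w y ^ 3) with hψ'
  have hw0 : ∀ y, 0 < w y := fun y => Real.sqrt_pos.2 (by positivity)
  have hδw : ∀ y, 0 < δ * w y := fun y => mul_pos hδ (hw0 y)
  have hwδ : ∀ y, δ ≤ w y := fun y => by
    calc δ = Real.sqrt (δ ^ 2) := (Real.sqrt_sq hδ.le).symm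
      _ ≤ w y := Real.sqrt_le_sqrt (by nlinarith [sq_nonneg (cos y)])
  have hψd : ∀ y, HasDerivAt ψ (ψ' y) y := fun y => hasDerivAt_psi hδ c y
  have hsc : ∀ y, sin y - c = ψ y * (δ * w y) := fun y => by
    simp only [hψ]; rw [div_mul_cancel₀ _ (hδw y).ne']
  have habs : ∀ y, |sin y - c| = |ψ y| * (δ * w y) := fun y => by
    conv_lhs => rw [hsc y]
    rw [abs_mul, abs_of_pos (hδw y)]
  refine ⟨fun y => φ (ψ y), fun y => φ' (ψ y) * ψ' y,
    {y | |sin y - c| < δ * Real.sqrt (cos y ^ 2 + δ ^ 2)}, ?_, ?_, ?_, ?_, ?_, ?_, ?_, ?_, ?_⟩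
  · -- derivative of the localiser
    intro y _; exact (hφd (ψ y)).comp y (hψd y)
  · -- continuity of its derivative
    have hψc : Continuous ψ := continuous_iff_continuousAt.2 fun y => (hψd y).continuousAt
    have hψ'c : Continuous ψ' := by
      refine Continuous.div (by fun_prop) (by fun_prop) fun y => (ne_of_gt ?_)
      exact mul_pos hδ (pow_pos (hw0 y) 3)
    exact ((hφ'c.comp hψc).mul hψ'c).continuousOn
  · -- periodicity
    simp only [hψ, hw, Real.sin_two_pi, Real.cos_two_pi, Real.sin_zero, Real.cos_zero]
  · intro y _; exact hφ1 _
  · -- `|χ′| ≤ 3/δ`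
    intro y _
    show |φ' (ψ y) * ψ' y| ≤ 3 / δ
    rcases lt_or_ge |ψ y| 1 with hlt | hge
    · have hband : |sin y - c| ≤ δ * Real.sqrt (cos y ^ 2 + δ ^ 2) := by
        rw [habs y]; exact mul_le_of_le_one_left (hδw y).le hlt.le
      have h1 := abs_psi_deriv_le hδ c y hband
      have h2 := hφ'2 (ψ y)
      rw [abs_mul]
      calc |φ' (ψ y)| * |ψ' y| ≤ 2 * (3 / (2 * δ)) :=
            mul_le_mul h2 h1 (abs_nonneg _) (by norm_num)
        _ = 3 / δ := by field_simp
    · rw [hφ'zero _ hge, zero_mul, abs_zero]; positivity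
  · -- sign
    intro y _
    show 0 ≤ φ (ψ y) * (sin y - c)
    rw [hsc y, ← mul_assoc]
    exact mul_nonneg (hφpos _) (hδw y).le
  · -- measurability
    exact measurableSet_lt (by fun_prop) (by fun_prop)
  · -- off the exceptional set
    intro y _ hyS
    simp only [mem_setOf_eq, not_lt] at hyS
    have hge : 1 ≤ |ψ y| := by
      rw [habs y] at hyS
      exact (le_mul_iff_one_le_left (hδw y)).mp hyS
    calc δ ^ 2 = δ * δ := sq δ
      _ ≤ δ * w y := mul_le_mul_of_nonneg_left (hwδ y) hδ.le
      _ ≤ |ψ y| * (δ * w y) := le_mul_of_one_le_left (hδw y).le hge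
      _ = φ (ψ y) * ψ y * (δ * w y) := by rw [hφsign _ hge]
      _ = φ (ψ y) * (sin y - c) := by rw [hsc y]; ring
  · -- the thin inequality
    intro f f' hf hf'
    have hvol := volume_localiserSet_le c hδ hδ4
    have hreal : volume.real ({y : ℝ | |sin y - c| < δ * Real.sqrt (cos y ^ 2 + δ ^ 2)}
        ∩ Ioc 0 (2 * π)) ≤ (8 * π + 32) * δ :=
      ENNReal.toReal_le_of_le_ofReal (by positivity) hvol
    have hθL : (8 * π + 32) * δ ≤ 2 * π / 4 := by
      have := (le_div_iff₀ (by positivity : (0:ℝ) < 2 * (8 * π + 32))).mp hδ₀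
      linarith
    have h := setIntegral_norm_sq_le_of_measure_le (L := 2 * π) (by positivity) hf hf' hreal hθL
    calc _ ≤ _ := h
      _ = _ := by ring

/-- The constant bookkeeping `4(C₀δ₀² + δ₀⁻² + 3²δ₀⁻⁶) = 4(π² + δ₀⁻² + 9δ₀⁻⁶)` with
`C₀ = 4(8π+32)²`, `δ₀ = π/(2(8π+32)) = π/(16π+64)`. [folklore] -/
private theorem const_eq :
    4 * (4 * (8 * π + 32) ^ 2 * (π / (2 * (8 * π + 32))) ^ 2 + ((π / (2 * (8 * π + 32))) ^ 2)⁻¹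
      + 3 ^ 2 * ((π / (2 * (8 * π + 32))) ^ (2 * 2 + 2))⁻¹)
    = 4 * (π ^ 2 + ((π / (16 * π + 64)) ^ 2)⁻¹ + 9 * ((π / (16 * π + 64)) ^ 6)⁻¹) := by
  have h1 : 4 * (8 * π + 32) ^ 2 * (π / (2 * (8 * π + 32))) ^ 2 = π ^ 2 := by
    field_simp
    ring
  have h2 : π / (2 * (8 * π + 32)) = π / (16 * π + 64) := by ring
  rw [h1, h2]; norm_num

/-- **Enhanced-dissipation half of the Kolmogorov crossover bound** (CZG Thm 1.1 with `m = 2` for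
`v = sin`, resolvent form, explicit constant): for `0 < ν ≤ |k|`, every level `c` and every `C²`
function `g` on `[0, 2π]` with twisted-periodic boundary values,
`√(ν|k|)·‖g‖ ≤ 4(π² + δ₀⁻² + 9δ₀⁻⁶)·‖−νg″ + ik(sin − c)g‖`, `δ₀ = π/(16π+64)`.
[cite: CotizelatiGallay2023, §1 Thm 1.1 and §2 Prop. 2.4] -/
theorem kolmogorov_resolvent_enhanced (c : ℝ) {ν k : ℝ} (hν : 0 < ν) (hk : k ≠ 0)
    (hνk : ν ≤ |k|) {g g' g'' : ℝ → ℂ} (hg : ∀ y ∈ Icc 0 (2 * π), HasDerivAt g (g' y) y)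
    (hg' : ∀ y ∈ Icc 0 (2 * π), HasDerivAt g' (g'' y) y)
    (hg'' : ContinuousOn g'' (Icc 0 (2 * π))) {ω : ℂ} (hω : ‖ω‖ = 1)
    (hbc : g (2 * π) = ω * g 0) (hbc' : g' (2 * π) = ω * g' 0) :
    Real.sqrt (ν * |k|) * Real.sqrt (∫ y in (0:ℝ)..2 * π, ‖g y‖ ^ 2)
      ≤ 4 * (π ^ 2 + ((π / (16 * π + 64)) ^ 2)⁻¹ + 9 * ((π / (16 * π + 64)) ^ 6)⁻¹)
        * Real.sqrt (∫ y in (0:ℝ)..2 * π,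
            ‖-(ν:ℂ) * g'' y + Complex.I * k * ((Real.sin y - c : ℝ) : ℂ) * g y‖ ^ 2) := by
  have hv : ContinuousOn (fun y => Real.sin y - c) (Icc 0 (2 * π)) := by fun_prop
  have hΛ : 0 < Real.sqrt (ν * |k|) := Real.sqrt_pos.2 (mul_pos hν (abs_pos.2 hk))
  have hΛeq : Real.sqrt (ν * |k|) ^ (2 + 2) = ν ^ 2 * k ^ 2 := by
    rw [show (2:ℕ) + 2 = 2 * 2 by norm_num, pow_mul, Real.sq_sqrt (by positivity), mul_pow, sq_abs]
  have h := resolvent_lower_bound_enhanced_of_thin (by positivity) hν hk hv (by positivity)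
    (by norm_num) (by positivity) (hasThinLevelSets_sin_sub c) hg hg' hg'' hω hbc hbc' hνk hΛ hΛeq
  rw [const_eq] at h
  exact h

/-- **Taylor-dispersion half of the Kolmogorov crossover bound** (same constant, regime `|k| ≤ ν`):
`(k²/ν)·‖g‖ ≤ 4(π² + δ₀⁻² + 9δ₀⁻⁶)·‖−νg″ + ik(sin − c)g‖`. [cite: CotizelatiGallay2023, §1 Thm 1.1 and §2 Prop. 2.4] -/
theorem kolmogorov_resolvent_taylor (c : ℝ) {ν k : ℝ} (hν : 0 < ν) (hk : k ≠ 0)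
    (hkν : |k| ≤ ν) {g g' g'' : ℝ → ℂ} (hg : ∀ y ∈ Icc 0 (2 * π), HasDerivAt g (g' y) y)
    (hg' : ∀ y ∈ Icc 0 (2 * π), HasDerivAt g' (g'' y) y)
    (hg'' : ContinuousOn g'' (Icc 0 (2 * π))) {ω : ℂ} (hω : ‖ω‖ = 1)
    (hbc : g (2 * π) = ω * g 0) (hbc' : g' (2 * π) = ω * g' 0) :
    k ^ 2 / ν * Real.sqrt (∫ y in (0:ℝ)..2 * π, ‖g y‖ ^ 2)
      ≤ 4 * (π ^ 2 + ((π / (16 * π + 64)) ^ 2)⁻¹ + 9 * ((π / (16 * π + 64)) ^ 6)⁻¹)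
        * Real.sqrt (∫ y in (0:ℝ)..2 * π,
            ‖-(ν:ℂ) * g'' y + Complex.I * k * ((Real.sin y - c : ℝ) : ℂ) * g y‖ ^ 2) := by
  have hv : ContinuousOn (fun y => Real.sin y - c) (Icc 0 (2 * π)) := by fun_prop
  have h := resolvent_lower_bound_taylor_of_thin (by positivity) hν hk hv (by positivity)
    (by norm_num) (by positivity) (hasThinLevelSets_sin_sub c) hg hg' hg'' hω hbc hbc' hkν
  rw [const_eq] at h
  exact h

end Assembly

end Literature.Analysis.FluidPDE.KolmogorovShear

end
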